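import Summits.ResolutionOfSingularities.ResolutionOfSingularities.Theorems.EquisingularLiftEquisingularLiftNatPointResolution
import HarnessLib

/-!
# [OURS · L1 W4.5(b) · EL♮] T-ISO-0-REL «POINT-RESOLVABLE FROM ANY STAGE» (res-L1-w45b-lead-2's TARGET (4), 2026-08-27T07:04:41Z)

Crux `EquisingularLiftNat` = stmt-ResolutionOfSingularities-20038 (route EquisingularLift), line `sections`; helper file
`--supports … --as helper` by res-type-022 (RESERVE volunteer, res-D-plan-1 ROUTING #14 (d)). HONEST FRAMING: OURS (cell
res-hironaka, slot W4.5(b)); NOT a statement of any manuscript; a RELATIVE form of the landed rung T-ISO-0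
(`target_elnat_of_pointResolution`, Theorems/EquisingularLiftEquisingularLiftNatPointResolution.lean, res-D-pv-029). AI-written,
weaker than expert review. No `sorry`; standard axioms.

WHAT IS PROVED (all over an ABSTRACT base: `O` a complete DVR with algebraically closed residue field, `q : P → Spec O` smooth
and proper, `Y ⊆ P` closed irreducible inside the special fibre — exactly the currency of `pointStep`, brick 2 of T-ISO-0).

* `pointResolution_from_stage` — THE RELATIVE RUNG. A stage predicate `Ch` over `P` implying `Split.Chain` and closed under
  horizontal E1 steps (regular `O`-flat centre over non-generic points of `Y`, special points inside the current strict
  transform); an UPSTAIRS stage `(X₁, σ₁, S₁)` with `Ch`, irreducible special fibre and good reduction at every special-fibre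
  point (NO smoothness of `X₁ → Spec O` is asked on this axis); DOWNSTAIRS any locally Noetherian `F₀`, a closed irreducible
  `T₀ ⊆ F₀`, an isomorphism `V(closure T₀)_red ≅ V(closure S₁)_red`, and a point-only resolution of `(F₀, T₀)` (the PtChain
  ∃-form of T-ISO-0: finitely many blow-ups of the successive ambients at NON-REGULAR CLOSED points of the successive reduced
  strict transforms, ending with a regular reduced strict transform). CONCLUSION: a `Ch`-stage `(X₂, σ₂, S₂)` with irreducible
  special fibre, good reduction at every special-fibre point and REGULAR reduced strict transform `V(closure S₂)_red`.
  PROOF = T-ISO-0's induction along the downstairs chain (`pointStep` at each step, the iso transported by brick 1), started at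
  the given stage instead of `(P, 𝟙, Y)`.
* `pointResolution_from_horizStage` — the same with `Ch :=` «horizontal E1 chain over `(P, Y)` w.r.t. `q`» (the registered
  clause, inlined), so ANY PREFIX of horizontal E1 steps (sections, nose lifts, Δ-curves, combs) may precede the point steps.
* `pointResolution_base` — the stage `(P, 𝟙, Y)`: abstract T-ISO-0 (irreducibility of the special fibre of `P` is INPUT here;
  for `ℙⁿ_O` it is `stub_projectiveAmbientFibre`).
* `nonempty_iso_subscheme_vanishingIdeal_image` — adapter: for a closed immersion `j : F → X` and a closed `T ⊆ F`,
  `V_F(T)_red ≅ V_X(j '' T)_red`; whence `pointResolution_from_horizStage_of_isClosedImmersion`: the downstairs datum may be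
  given by a closed immersion `j : F₀ → X₁` (e.g. the special fibre of `X₁`) and a closed irreducible `T₀` with `j '' T₀ = S₁`.
* `pointResolution_rel_smooth` — lead-2's wording of TARGET (4): if moreover `X₁ → Spec O` is SMOOTH (true whenever every centre
  so far was `O`-smooth), the point steps form a horizontal E1 chain over `(X₁, closure S₁)` w.r.t. `σ₁ ≫ q` (apply
  `pointResolution_base` to the base `X₁`), which composes back to a horizontal E1 chain over `(P, Y)` (`horizChainE1_comp`,
  p502282).

References: Theorems/…NatPointResolution.lean (T-ISO-0, p505885), …NatPointStep.lean (p505032), …NatPointStepTransport.lean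
(p504357), …NatHorizChainE1Sections.lean (p502282); Liu 2002 §8.1/§9.2; res-L1-w45b-lead-2 STATUS 2026-08-27T07:04:41Z TARGETS (4)(5). -/

set_option linter.dupNamespace false -- mandated namespace `Summit.<Summit>.<Problem>` of this single-conjunct summit
set_option linter.overlappingInstances false -- signatures carry `[IsDomain O] [IsDiscreteValuationRing O]`

noncomputable section

open CategoryTheory CategoryTheory.Limits AlgebraicGeometry TopologicalSpace Topology
open Literature.AlgebraicGeometry.Resolution
open AlgebraicGeometry.Scheme.IdealSheafData
open Summit.ResolutionOfSingularities.ResolutionOfSingularities.Theses.EquisingularLift.Split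
open Summit.ResolutionOfSingularities.ResolutionOfSingularities.Cruxes.EquisingularLift.StrataSplit

namespace Summit.ResolutionOfSingularities.ResolutionOfSingularities.Cruxes.EquisingularLiftNat.Sections

/-! ## Adapter: reduced induced structure on a closed subset of a closed subscheme -/

/-- For a closed immersion `j : F → X` and a closed `T ⊆ F`, the reduced closed subscheme of `F` on `T` is isomorphic to the
reduced closed subscheme of `X` on `j '' T` (both are reduced closed subschemes of `X` with the same support). [folklore] -/
theorem nonempty_iso_subscheme_vanishingIdeal_image {F X : Scheme.{0}} (j : F ⟶ X) [IsClosedImmersion j] (T : Closeds F) :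
    Nonempty ((vanishingIdeal T).subscheme ≅
      (vanishingIdeal (⟨j '' (T : Set F), j.isClosedEmbedding.isClosedMap _ T.isClosed⟩ : Closeds X)).subscheme) := by
  haveI : IsReduced (vanishingIdeal T).subscheme := ComponentGluing.isReduced_subscheme_vanishingIdeal T
  let f : (vanishingIdeal T).subscheme ⟶ X := (vanishingIdeal T).subschemeι ≫ j
  have hrange : Set.range f = j '' (T : Set F) := by
    rw [← ComponentGluing.range_subschemeι_vanishingIdeal T, ← Set.range_comp]
    ext x
    simp only [Set.mem_range, Function.comp_apply, f, Scheme.Hom.comp_apply]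
  have hZ : (⟨j '' (T : Set F), j.isClosedEmbedding.isClosedMap _ T.isClosed⟩ : Closeds X) =
      ⟨Set.range f, f.isClosedEmbedding.isClosed_range⟩ := Closeds.ext hrange.symm
  rw [hZ]
  obtain ⟨e⟩ := nonempty_iso_subscheme_vanishingIdeal_range f
  exact ⟨e.symm⟩

/-- Variant of `nonempty_iso_subscheme_vanishingIdeal_image` for a closed SET `T₀ ⊆ F` with prescribed image `S = j '' T₀`,
in the `closure`-currency of the chains: `V(closure T₀)_red ≅ V(closure S)_red`. [folklore] -/
theorem nonempty_iso_subscheme_vanishingIdeal_closure_of_image_eq {F X : Scheme.{0}} (j : F ⟶ X) [IsClosedImmersion j]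
    {T₀ : Set F} (hT₀ : IsClosed T₀) {S : Set X} (hS : j '' T₀ = S) :
    Nonempty ((vanishingIdeal (⟨closure T₀, isClosed_closure⟩ : Closeds F)).subscheme ≅
      (vanishingIdeal (⟨closure S, isClosed_closure⟩ : Closeds X)).subscheme) := by
  have hScl : IsClosed S := hS ▸ j.isClosedEmbedding.isClosedMap _ hT₀
  have h1 : (⟨closure T₀, isClosed_closure⟩ : Closeds F) = ⟨T₀, hT₀⟩ := Closeds.ext hT₀.closure_eq
  have h2 : (⟨closure S, isClosed_closure⟩ : Closeds X) =
      ⟨j '' ((⟨T₀, hT₀⟩ : Closeds F) : Set F), j.isClosedEmbedding.isClosedMap _ (⟨T₀, hT₀⟩ : Closeds F).isClosed⟩ :=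
    Closeds.ext (by change closure S = j '' T₀; rw [hScl.closure_eq, hS])
  rw [h1, h2]
  exact nonempty_iso_subscheme_vanishingIdeal_image j ⟨T₀, hT₀⟩

/-! ## The relative rung -/

/-- **T-ISO-0-REL «point-resolvable from any stage», abstract form.** See the module docstring: T-ISO-0's induction along a
downstairs point-only resolution, run from an arbitrary `Ch`-stage `(X₁, σ₁, S₁)` with irreducible special fibre and good
reduction at every special-fibre point, the downstairs start `(F₀, T₀)` being identified with the stage by an isomorphism of
reduced strict transforms. [folklore; Liu 2002 §8.1/§9.2] -/
theorem pointResolution_from_stage (O : Type) [CommRing O] [IsDomain O] [IsDiscreteValuationRing O]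
    [IsAdicComplete (IsLocalRing.maximalIdeal O) O] [IsAlgClosed (IsLocalRing.ResidueField O)]
    (P : Scheme.{0}) (q : P ⟶ Spec (.of O)) (Y : Closeds P)
    (Ch : ∀ X' : Scheme.{0}, (X' ⟶ P) → Set X' → Prop)
    (hChain : ∀ (X' : Scheme.{0}) (σ : X' ⟶ P) (S : Set X'), Ch X' σ S → Chain P (Y : Set P) X' σ S)
    (hStep : ∀ (X' X'' : Scheme.{0}) (σ' : X' ⟶ P) (S' : Set X') (C : X'.IdealSheafData) (τ : X'' ⟶ X'),
      Ch X' σ' S' → IsBlowup τ C → Scheme.IsRegular C.subscheme → Flat (C.subschemeι ≫ σ' ≫ q) →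
      σ' '' (C.support : Set X') ⊆ {x : P | ¬ IsGenericPoint x (Y : Set P)} →
      (C.support : Set X') ∩ (σ' ≫ q) ⁻¹' {IsLocalRing.closedPoint O} ⊆ S' →
      Ch X'' (τ ≫ σ') (closure (τ ⁻¹' (S' \ (C.support : Set X')))))
    (hq : Smooth q) (hqp : IsProper q)
    (hY : (Y : Set P) ⊆ q ⁻¹' {IsLocalRing.closedPoint O}) (hYirr : IsIrreducible (Y : Set P))
    -- the upstairs stage
    (X₁ : Scheme.{0}) (σ₁ : X₁ ⟶ P) (S₁ : Set X₁) (hCh : Ch X₁ σ₁ S₁)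
    (hirr : IsIrreducible ((σ₁ ≫ q) ⁻¹' {IsLocalRing.closedPoint O}))
    (hgood : ∀ w : X₁, (σ₁ ≫ q) w = IsLocalRing.closedPoint O → GoodAt (σ₁ ≫ q) w)
    -- the downstairs start, identified with the stage
    (F₀ : Scheme.{0}) [IsLocallyNoetherian F₀] (T₀ : Set F₀) (hT₀cl : IsClosed T₀) (hT₀irr : IsIrreducible T₀)
    (e : (vanishingIdeal (⟨closure T₀, isClosed_closure⟩ : Closeds F₀)).subscheme ≅
      (vanishingIdeal (⟨closure S₁, isClosed_closure⟩ : Closeds X₁)).subscheme)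
    -- the downstairs point-only resolution
    (hres : ∃ (F' : Scheme.{0}) (ρ' : F' ⟶ F₀) (T' : Set F'),
      (∀ Q : (∀ F₁ : Scheme.{0}, (F₁ ⟶ F₀) → Set F₁ → Prop), Q F₀ (𝟙 F₀) T₀ →
        (∀ (F₁ F₂ : Scheme.{0}) (ρ : F₁ ⟶ F₀) (T₁ : Set F₁)
          (x : ↥(vanishingIdeal (⟨closure T₁, isClosed_closure⟩ : Closeds F₁)).subscheme) (υ : F₂ ⟶ F₁)
          (hx : IsClosed ({((vanishingIdeal (⟨closure T₁, isClosed_closure⟩ : Closeds F₁)).subschemeι x : F₁)} : Set F₁)),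
          Q F₁ ρ T₁ →
          ¬ IsRegularLocalRing ((vanishingIdeal (⟨closure T₁, isClosed_closure⟩ : Closeds F₁)).subscheme.presheaf.stalk x) →
          IsBlowup υ (vanishingIdeal
            (⟨{((vanishingIdeal (⟨closure T₁, isClosed_closure⟩ : Closeds F₁)).subschemeι x : F₁)}, hx⟩ : Closeds F₁)) →
          Q F₂ (υ ≫ ρ) (closure (υ ⁻¹' (T₁ \
            {((vanishingIdeal (⟨closure T₁, isClosed_closure⟩ : Closeds F₁)).subschemeι x : F₁)})))) →
        Q F' ρ' T') ∧
      Scheme.IsRegular (vanishingIdeal (⟨closure T', isClosed_closure⟩ : Closeds F')).subscheme) :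
    ∃ (X₂ : Scheme.{0}) (σ₂ : X₂ ⟶ P) (S₂ : Set X₂),
      Ch X₂ σ₂ S₂ ∧ IsIrreducible ((σ₂ ≫ q) ⁻¹' {IsLocalRing.closedPoint O}) ∧
      (∀ w : X₂, (σ₂ ≫ q) w = IsLocalRing.closedPoint O → GoodAt (σ₂ ≫ q) w) ∧
      Scheme.IsRegular (vanishingIdeal (⟨closure S₂, isClosed_closure⟩ : Closeds X₂)).subscheme := by
  classical
  -- adapted from `target_elnat_of_pointResolution` (Theorems/EquisingularLiftEquisingularLiftNatPointResolution.lean):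
  -- THE DOWNSTAIRS INDUCTION PREDICATE — closed irreducible strict transform, locally Noetherian ambient, and an upstairs
  -- `Ch`-stage with irreducible special fibre and good reduction whose reduced strict transform is ISOMORPHIC to the
  -- downstairs one
  let QD : ∀ F₁ : Scheme.{0}, (F₁ ⟶ F₀) → Set F₁ → Prop :=
    fun F₁ _ T₁ => IsClosed T₁ ∧ IsLocallyNoetherian F₁ ∧ IsIrreducible T₁ ∧
      ∃ (X' : Scheme.{0}) (σ' : X' ⟶ P) (S' : Set X'),
        Ch X' σ' S' ∧ IsIrreducible ((σ' ≫ q) ⁻¹' {IsLocalRing.closedPoint O}) ∧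
        (∀ w : X', (σ' ≫ q) w = IsLocalRing.closedPoint O → GoodAt (σ' ≫ q) w) ∧
        Nonempty ((vanishingIdeal (⟨closure T₁, isClosed_closure⟩ : Closeds F₁)).subscheme ≅
          (vanishingIdeal (⟨closure S', isClosed_closure⟩ : Closeds X')).subscheme)
  obtain ⟨F', ρ', T', hclos, hregD⟩ := hres
  have hQD : QD F' ρ' T' := by
    refine hclos QD ?_ ?_
    · -- BASE: the given stage
      exact ⟨hT₀cl, inferInstance, hT₀irr, X₁, σ₁, S₁, hCh, hirr, hgood, ⟨e⟩⟩
    · -- STEP: `pointStep`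
      intro F₁ F₂ ρ T₁ x υ hx hQ₁ hxreg hυ
      obtain ⟨hT₁cl, hF₁, hT₁irr, X', σ', S', hChX, hirrX, hgoodX, ⟨eX⟩⟩ := hQ₁
      haveI := hF₁
      obtain ⟨X'', σ'', S'', hCh'', hirr'', hgood'', hF₂, hT₂irr, hiso⟩ :=
        pointStep O P q Y Ch hChain hStep hq hqp hY hYirr X' σ' S' hChX hirrX hgoodX F₁ F₂ T₁ hT₁cl hT₁irr x hx hxreg
          υ hυ eX
      exact ⟨isClosed_closure, hF₂, hT₂irr, X'', σ'', S'', hCh'', hirr'', hgood'', hiso⟩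
  -- THE END: transport the downstairs regularity through the isomorphism
  obtain ⟨-, -, -, X₂, σ₂, S₂, hCh₂, hirr₂, hgood₂, ⟨e₂⟩⟩ := hQD
  exact ⟨X₂, σ₂, S₂, hCh₂, hirr₂, hgood₂, Scheme.IsRegular.of_iso e₂.hom hregD⟩

/-- **T-ISO-0-REL for the registered clause: point-resolvable from any HORIZONTAL E1 stage.** `pointResolution_from_stage` with
`Ch :=` «`(X', σ', S')` is reached from `(P, 𝟙, Y)` by blow-ups in regular `O`-FLAT centres over non-generic points of `Y` whose
special points lie in the current strict transform» (inlined). Any prefix of such steps may precede the point steps. [folklore] -/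
theorem pointResolution_from_horizStage (O : Type) [CommRing O] [IsDomain O] [IsDiscreteValuationRing O]
    [IsAdicComplete (IsLocalRing.maximalIdeal O) O] [IsAlgClosed (IsLocalRing.ResidueField O)]
    (P : Scheme.{0}) (q : P ⟶ Spec (.of O)) (Y : Closeds P)
    (hq : Smooth q) (hqp : IsProper q)
    (hY : (Y : Set P) ⊆ q ⁻¹' {IsLocalRing.closedPoint O}) (hYirr : IsIrreducible (Y : Set P))
    -- the upstairs stage: a horizontal E1 chain over `(P, Y)`
    (X₁ : Scheme.{0}) (σ₁ : X₁ ⟶ P) (S₁ : Set X₁)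
    (hH : ∀ Q : (∀ X' : Scheme.{0}, (X' ⟶ P) → Set X' → Prop), Q P (𝟙 P) (Y : Set P) →
      (∀ (X' X'' : Scheme.{0}) (σ' : X' ⟶ P) (Y' : Set X') (C : X'.IdealSheafData) (τ : X'' ⟶ X'),
        Q X' σ' Y' → IsBlowup τ C → Scheme.IsRegular C.subscheme → Flat (C.subschemeι ≫ σ' ≫ q) →
        σ' '' (C.support : Set X') ⊆ {x : P | ¬ IsGenericPoint x (Y : Set P)} →
        (C.support : Set X') ∩ (σ' ≫ q) ⁻¹' {IsLocalRing.closedPoint O} ⊆ Y' →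
        Q X'' (τ ≫ σ') (closure (τ ⁻¹' (Y' \ (C.support : Set X'))))) →
      Q X₁ σ₁ S₁)
    (hirr : IsIrreducible ((σ₁ ≫ q) ⁻¹' {IsLocalRing.closedPoint O}))
    (hgood : ∀ w : X₁, (σ₁ ≫ q) w = IsLocalRing.closedPoint O → GoodAt (σ₁ ≫ q) w)
    -- the downstairs start, identified with the stage
    (F₀ : Scheme.{0}) [IsLocallyNoetherian F₀] (T₀ : Set F₀) (hT₀cl : IsClosed T₀) (hT₀irr : IsIrreducible T₀)
    (e : (vanishingIdeal (⟨closure T₀, isClosed_closure⟩ : Closeds F₀)).subscheme ≅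
      (vanishingIdeal (⟨closure S₁, isClosed_closure⟩ : Closeds X₁)).subscheme)
    -- the downstairs point-only resolution
    (hres : ∃ (F' : Scheme.{0}) (ρ' : F' ⟶ F₀) (T' : Set F'),
      (∀ Q : (∀ F₁ : Scheme.{0}, (F₁ ⟶ F₀) → Set F₁ → Prop), Q F₀ (𝟙 F₀) T₀ →
        (∀ (F₁ F₂ : Scheme.{0}) (ρ : F₁ ⟶ F₀) (T₁ : Set F₁)
          (x : ↥(vanishingIdeal (⟨closure T₁, isClosed_closure⟩ : Closeds F₁)).subscheme) (υ : F₂ ⟶ F₁)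
          (hx : IsClosed ({((vanishingIdeal (⟨closure T₁, isClosed_closure⟩ : Closeds F₁)).subschemeι x : F₁)} : Set F₁)),
          Q F₁ ρ T₁ →
          ¬ IsRegularLocalRing ((vanishingIdeal (⟨closure T₁, isClosed_closure⟩ : Closeds F₁)).subscheme.presheaf.stalk x) →
          IsBlowup υ (vanishingIdeal
            (⟨{((vanishingIdeal (⟨closure T₁, isClosed_closure⟩ : Closeds F₁)).subschemeι x : F₁)}, hx⟩ : Closeds F₁)) →
          Q F₂ (υ ≫ ρ) (closure (υ ⁻¹' (T₁ \
            {((vanishingIdeal (⟨closure T₁, isClosed_closure⟩ : Closeds F₁)).subschemeι x : F₁)})))) →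
        Q F' ρ' T') ∧
      Scheme.IsRegular (vanishingIdeal (⟨closure T', isClosed_closure⟩ : Closeds F')).subscheme) :
    ∃ (X₂ : Scheme.{0}) (σ₂ : X₂ ⟶ P) (S₂ : Set X₂),
      (∀ Q : (∀ X' : Scheme.{0}, (X' ⟶ P) → Set X' → Prop), Q P (𝟙 P) (Y : Set P) →
        (∀ (X' X'' : Scheme.{0}) (σ' : X' ⟶ P) (Y' : Set X') (C : X'.IdealSheafData) (τ : X'' ⟶ X'),
          Q X' σ' Y' → IsBlowup τ C → Scheme.IsRegular C.subscheme → Flat (C.subschemeι ≫ σ' ≫ q) →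
          σ' '' (C.support : Set X') ⊆ {x : P | ¬ IsGenericPoint x (Y : Set P)} →
          (C.support : Set X') ∩ (σ' ≫ q) ⁻¹' {IsLocalRing.closedPoint O} ⊆ Y' →
          Q X'' (τ ≫ σ') (closure (τ ⁻¹' (Y' \ (C.support : Set X'))))) →
        Q X₂ σ₂ S₂) ∧
      IsIrreducible ((σ₂ ≫ q) ⁻¹' {IsLocalRing.closedPoint O}) ∧
      (∀ w : X₂, (σ₂ ≫ q) w = IsLocalRing.closedPoint O → GoodAt (σ₂ ≫ q) w) ∧
      Scheme.IsRegular (vanishingIdeal (⟨closure S₂, isClosed_closure⟩ : Closeds X₂)).subscheme := by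
  -- the horizontal E1 closure as a stage predicate: it implies `Chain` (forget flatness and E1) and is closed under its steps
  refine pointResolution_from_stage O P q Y
    (fun X' σ' S' => ∀ Q : (∀ X' : Scheme.{0}, (X' ⟶ P) → Set X' → Prop), Q P (𝟙 P) (Y : Set P) →
      (∀ (X' X'' : Scheme.{0}) (σ' : X' ⟶ P) (Y' : Set X') (C : X'.IdealSheafData) (τ : X'' ⟶ X'),
        Q X' σ' Y' → IsBlowup τ C → Scheme.IsRegular C.subscheme → Flat (C.subschemeι ≫ σ' ≫ q) →
        σ' '' (C.support : Set X') ⊆ {x : P | ¬ IsGenericPoint x (Y : Set P)} →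
        (C.support : Set X') ∩ (σ' ≫ q) ⁻¹' {IsLocalRing.closedPoint O} ⊆ Y' →
        Q X'' (τ ≫ σ') (closure (τ ⁻¹' (Y' \ (C.support : Set X'))))) →
      Q X' σ' S')
    (fun X' σ S h => chain_of_horizChainE1 q (Y : Set P) σ S h)
    (fun X' X'' σ' S' C τ h hb hr hfl hg' hE Q h0 hs => hs X' X'' σ' S' C τ (h Q h0 hs) hb hr hfl hg' hE)
    hq hqp hY hYirr X₁ σ₁ S₁ hH hirr hgood F₀ T₀ hT₀cl hT₀irr e hres

/-- **ABSTRACT T-ISO-0** (the stage `(P, 𝟙, Y)` of `pointResolution_from_horizStage`): over any smooth proper `q : P → Spec O`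
with IRREDUCIBLE special fibre (input), a closed irreducible `Y` inside the special fibre whose reduced structure is identified
with a downstairs `V(closure T₀)_red ⊆ F₀` that is point-resolvable, the horizontal form of EL♮ holds for `(P, Y)`. [folklore] -/
theorem pointResolution_base (O : Type) [CommRing O] [IsDomain O] [IsDiscreteValuationRing O]
    [IsAdicComplete (IsLocalRing.maximalIdeal O) O] [IsAlgClosed (IsLocalRing.ResidueField O)]
    (P : Scheme.{0}) (q : P ⟶ Spec (.of O)) (Y : Closeds P)
    (hq : Smooth q) (hqp : IsProper q) (hirr₀ : IsIrreducible (q ⁻¹' {IsLocalRing.closedPoint O}))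
    (hY : (Y : Set P) ⊆ q ⁻¹' {IsLocalRing.closedPoint O}) (hYirr : IsIrreducible (Y : Set P))
    (F₀ : Scheme.{0}) [IsLocallyNoetherian F₀] (T₀ : Set F₀) (hT₀cl : IsClosed T₀) (hT₀irr : IsIrreducible T₀)
    (e : (vanishingIdeal (⟨closure T₀, isClosed_closure⟩ : Closeds F₀)).subscheme ≅ (vanishingIdeal Y).subscheme)
    (hres : ∃ (F' : Scheme.{0}) (ρ' : F' ⟶ F₀) (T' : Set F'),
      (∀ Q : (∀ F₁ : Scheme.{0}, (F₁ ⟶ F₀) → Set F₁ → Prop), Q F₀ (𝟙 F₀) T₀ →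
        (∀ (F₁ F₂ : Scheme.{0}) (ρ : F₁ ⟶ F₀) (T₁ : Set F₁)
          (x : ↥(vanishingIdeal (⟨closure T₁, isClosed_closure⟩ : Closeds F₁)).subscheme) (υ : F₂ ⟶ F₁)
          (hx : IsClosed ({((vanishingIdeal (⟨closure T₁, isClosed_closure⟩ : Closeds F₁)).subschemeι x : F₁)} : Set F₁)),
          Q F₁ ρ T₁ →
          ¬ IsRegularLocalRing ((vanishingIdeal (⟨closure T₁, isClosed_closure⟩ : Closeds F₁)).subscheme.presheaf.stalk x) →
          IsBlowup υ (vanishingIdeal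
            (⟨{((vanishingIdeal (⟨closure T₁, isClosed_closure⟩ : Closeds F₁)).subschemeι x : F₁)}, hx⟩ : Closeds F₁)) →
          Q F₂ (υ ≫ ρ) (closure (υ ⁻¹' (T₁ \
            {((vanishingIdeal (⟨closure T₁, isClosed_closure⟩ : Closeds F₁)).subschemeι x : F₁)})))) →
        Q F' ρ' T') ∧
      Scheme.IsRegular (vanishingIdeal (⟨closure T', isClosed_closure⟩ : Closeds F')).subscheme) :
    ∃ (X₂ : Scheme.{0}) (σ₂ : X₂ ⟶ P) (S₂ : Set X₂),
      (∀ Q : (∀ X' : Scheme.{0}, (X' ⟶ P) → Set X' → Prop), Q P (𝟙 P) (Y : Set P) →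
        (∀ (X' X'' : Scheme.{0}) (σ' : X' ⟶ P) (Y' : Set X') (C : X'.IdealSheafData) (τ : X'' ⟶ X'),
          Q X' σ' Y' → IsBlowup τ C → Scheme.IsRegular C.subscheme → Flat (C.subschemeι ≫ σ' ≫ q) →
          σ' '' (C.support : Set X') ⊆ {x : P | ¬ IsGenericPoint x (Y : Set P)} →
          (C.support : Set X') ∩ (σ' ≫ q) ⁻¹' {IsLocalRing.closedPoint O} ⊆ Y' →
          Q X'' (τ ≫ σ') (closure (τ ⁻¹' (Y' \ (C.support : Set X'))))) →
        Q X₂ σ₂ S₂) ∧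
      IsIrreducible ((σ₂ ≫ q) ⁻¹' {IsLocalRing.closedPoint O}) ∧
      (∀ w : X₂, (σ₂ ≫ q) w = IsLocalRing.closedPoint O → GoodAt (σ₂ ≫ q) w) ∧
      Scheme.IsRegular (vanishingIdeal (⟨closure S₂, isClosed_closure⟩ : Closeds X₂)).subscheme := by
  have hZ : (⟨closure (Y : Set P), isClosed_closure⟩ : Closeds P) = Y := Closeds.ext Y.isClosed.closure_eq
  refine pointResolution_from_horizStage O P q Y hq hqp hY hYirr P (𝟙 P) (Y : Set P) (fun Q h0 _ => h0) ?_ ?_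
    F₀ T₀ hT₀cl hT₀irr (e ≪≫ eqToIso (by rw [hZ])) hres
  · simpa only [Category.id_comp] using hirr₀
  · intro w _
    rw [Category.id_comp]
    exact stub_goodAtOfSmooth O P q hq w

/-- **T-ISO-0-REL with the downstairs start given by a closed immersion** (e.g. the special fibre of the stage): if
`j : F₀ → X₁` is a closed immersion and `T₀ ⊆ F₀` is closed irreducible with `j '' T₀ = S₁`, the identification
`V(closure T₀)_red ≅ V(closure S₁)_red` of `pointResolution_from_horizStage` is supplied by
`nonempty_iso_subscheme_vanishingIdeal_closure_of_image_eq`, and `F₀` is locally Noetherian because `X₁` is. [folklore] -/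
theorem pointResolution_from_horizStage_of_isClosedImmersion (O : Type) [CommRing O] [IsDomain O] [IsDiscreteValuationRing O]
    [IsAdicComplete (IsLocalRing.maximalIdeal O) O] [IsAlgClosed (IsLocalRing.ResidueField O)]
    (P : Scheme.{0}) (q : P ⟶ Spec (.of O)) (Y : Closeds P)
    (hq : Smooth q) (hqp : IsProper q)
    (hY : (Y : Set P) ⊆ q ⁻¹' {IsLocalRing.closedPoint O}) (hYirr : IsIrreducible (Y : Set P))
    (X₁ : Scheme.{0}) (σ₁ : X₁ ⟶ P) (S₁ : Set X₁)
    (hH : ∀ Q : (∀ X' : Scheme.{0}, (X' ⟶ P) → Set X' → Prop), Q P (𝟙 P) (Y : Set P) →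
      (∀ (X' X'' : Scheme.{0}) (σ' : X' ⟶ P) (Y' : Set X') (C : X'.IdealSheafData) (τ : X'' ⟶ X'),
        Q X' σ' Y' → IsBlowup τ C → Scheme.IsRegular C.subscheme → Flat (C.subschemeι ≫ σ' ≫ q) →
        σ' '' (C.support : Set X') ⊆ {x : P | ¬ IsGenericPoint x (Y : Set P)} →
        (C.support : Set X') ∩ (σ' ≫ q) ⁻¹' {IsLocalRing.closedPoint O} ⊆ Y' →
        Q X'' (τ ≫ σ') (closure (τ ⁻¹' (Y' \ (C.support : Set X'))))) →
      Q X₁ σ₁ S₁)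
    (hirr : IsIrreducible ((σ₁ ≫ q) ⁻¹' {IsLocalRing.closedPoint O}))
    (hgood : ∀ w : X₁, (σ₁ ≫ q) w = IsLocalRing.closedPoint O → GoodAt (σ₁ ≫ q) w)
    (F₀ : Scheme.{0}) (j : F₀ ⟶ X₁) [IsClosedImmersion j] (T₀ : Set F₀) (hT₀cl : IsClosed T₀) (hT₀irr : IsIrreducible T₀)
    (hjT₀ : j '' T₀ = S₁)
    (hres : ∃ (F' : Scheme.{0}) (ρ' : F' ⟶ F₀) (T' : Set F'),
      (∀ Q : (∀ F₁ : Scheme.{0}, (F₁ ⟶ F₀) → Set F₁ → Prop), Q F₀ (𝟙 F₀) T₀ →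
        (∀ (F₁ F₂ : Scheme.{0}) (ρ : F₁ ⟶ F₀) (T₁ : Set F₁)
          (x : ↥(vanishingIdeal (⟨closure T₁, isClosed_closure⟩ : Closeds F₁)).subscheme) (υ : F₂ ⟶ F₁)
          (hx : IsClosed ({((vanishingIdeal (⟨closure T₁, isClosed_closure⟩ : Closeds F₁)).subschemeι x : F₁)} : Set F₁)),
          Q F₁ ρ T₁ →
          ¬ IsRegularLocalRing ((vanishingIdeal (⟨closure T₁, isClosed_closure⟩ : Closeds F₁)).subscheme.presheaf.stalk x) →
          IsBlowup υ (vanishingIdeal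
            (⟨{((vanishingIdeal (⟨closure T₁, isClosed_closure⟩ : Closeds F₁)).subschemeι x : F₁)}, hx⟩ : Closeds F₁)) →
          Q F₂ (υ ≫ ρ) (closure (υ ⁻¹' (T₁ \
            {((vanishingIdeal (⟨closure T₁, isClosed_closure⟩ : Closeds F₁)).subschemeι x : F₁)})))) →
        Q F' ρ' T') ∧
      Scheme.IsRegular (vanishingIdeal (⟨closure T', isClosed_closure⟩ : Closeds F')).subscheme) :
    ∃ (X₂ : Scheme.{0}) (σ₂ : X₂ ⟶ P) (S₂ : Set X₂),
      (∀ Q : (∀ X' : Scheme.{0}, (X' ⟶ P) → Set X' → Prop), Q P (𝟙 P) (Y : Set P) →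
        (∀ (X' X'' : Scheme.{0}) (σ' : X' ⟶ P) (Y' : Set X') (C : X'.IdealSheafData) (τ : X'' ⟶ X'),
          Q X' σ' Y' → IsBlowup τ C → Scheme.IsRegular C.subscheme → Flat (C.subschemeι ≫ σ' ≫ q) →
          σ' '' (C.support : Set X') ⊆ {x : P | ¬ IsGenericPoint x (Y : Set P)} →
          (C.support : Set X') ∩ (σ' ≫ q) ⁻¹' {IsLocalRing.closedPoint O} ⊆ Y' →
          Q X'' (τ ≫ σ') (closure (τ ⁻¹' (Y' \ (C.support : Set X'))))) →
        Q X₂ σ₂ S₂) ∧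
      IsIrreducible ((σ₂ ≫ q) ⁻¹' {IsLocalRing.closedPoint O}) ∧
      (∀ w : X₂, (σ₂ ≫ q) w = IsLocalRing.closedPoint O → GoodAt (σ₂ ≫ q) w) ∧
      Scheme.IsRegular (vanishingIdeal (⟨closure S₂, isClosed_closure⟩ : Closeds X₂)).subscheme := by
  -- `X₁` is locally Noetherian (a chain over the smooth `P`), hence so is the closed subscheme `F₀`
  haveI := hq
  have hPnoeth : IsLocallyNoetherian P := LocallyOfFiniteType.isLocallyNoetherian q
  have hPreg : Scheme.IsRegular P := fun y => (stub_goodAtOfSmooth O P q hq y).1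
  obtain ⟨hnoeth₁, -, -⟩ := chain_isRegular P (Y : Set P) X₁ σ₁ S₁ (chain_of_horizChainE1 q (Y : Set P) σ₁ S₁ hH) hPnoeth hPreg
  haveI := hnoeth₁
  haveI : IsLocallyNoetherian F₀ := LocallyOfFiniteType.isLocallyNoetherian j
  obtain ⟨e⟩ := nonempty_iso_subscheme_vanishingIdeal_closure_of_image_eq j hT₀cl hjT₀
  exact pointResolution_from_horizStage O P q Y hq hqp hY hYirr X₁ σ₁ S₁ hH hirr hgood F₀ T₀ hT₀cl hT₀irr e hres

/-- **TARGET (4) in res-L1-w45b-lead-2's wording: point-resolvable FROM ANY `O`-SMOOTH STAGE.** Base `(P, q, Y)` as above;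
`(X₁, σ₁, S₁)` a horizontal E1 stage over `(P, Y)` whose structure morphism `σ₁ ≫ q : X₁ → Spec O` is SMOOTH, with irreducible
special fibre; downstairs a point-only resolution of some `V(closure T₀)_red ≅ V(closure S₁)_red`. Then the point steps give a
horizontal E1 chain `(X₂, σ₂, S₂)` OVER `(X₁, closure S₁)` w.r.t. `σ₁ ≫ q` (abstract T-ISO-0 for the base `X₁`; good reduction of
`X₁` is automatic from smoothness), and `(X₂, σ₂ ≫ σ₁, S₂)` is a horizontal E1 chain over `(P, Y)` (`horizChainE1_comp`) with
irreducible special fibre, good reduction at every special-fibre point and regular reduced strict transform. [folklore] -/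
theorem pointResolution_rel_smooth (O : Type) [CommRing O] [IsDomain O] [IsDiscreteValuationRing O]
    [IsAdicComplete (IsLocalRing.maximalIdeal O) O] [IsAlgClosed (IsLocalRing.ResidueField O)]
    (P : Scheme.{0}) (q : P ⟶ Spec (.of O)) (Y : Closeds P)
    (hq : Smooth q) (hqp : IsProper q)
    (hY : (Y : Set P) ⊆ q ⁻¹' {IsLocalRing.closedPoint O}) (hYirr : IsIrreducible (Y : Set P))
    (X₁ : Scheme.{0}) (σ₁ : X₁ ⟶ P) (S₁ : Set X₁)
    (hH : ∀ Q : (∀ X' : Scheme.{0}, (X' ⟶ P) → Set X' → Prop), Q P (𝟙 P) (Y : Set P) →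
      (∀ (X' X'' : Scheme.{0}) (σ' : X' ⟶ P) (Y' : Set X') (C : X'.IdealSheafData) (τ : X'' ⟶ X'),
        Q X' σ' Y' → IsBlowup τ C → Scheme.IsRegular C.subscheme → Flat (C.subschemeι ≫ σ' ≫ q) →
        σ' '' (C.support : Set X') ⊆ {x : P | ¬ IsGenericPoint x (Y : Set P)} →
        (C.support : Set X') ∩ (σ' ≫ q) ⁻¹' {IsLocalRing.closedPoint O} ⊆ Y' →
        Q X'' (τ ≫ σ') (closure (τ ⁻¹' (Y' \ (C.support : Set X'))))) →
      Q X₁ σ₁ S₁)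
    (hsm₁ : Smooth (σ₁ ≫ q)) (hirr : IsIrreducible ((σ₁ ≫ q) ⁻¹' {IsLocalRing.closedPoint O}))
    (F₀ : Scheme.{0}) [IsLocallyNoetherian F₀] (T₀ : Set F₀) (hT₀cl : IsClosed T₀) (hT₀irr : IsIrreducible T₀)
    (e : (vanishingIdeal (⟨closure T₀, isClosed_closure⟩ : Closeds F₀)).subscheme ≅
      (vanishingIdeal (⟨closure S₁, isClosed_closure⟩ : Closeds X₁)).subscheme)
    (hres : ∃ (F' : Scheme.{0}) (ρ' : F' ⟶ F₀) (T' : Set F'),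
      (∀ Q : (∀ F₁ : Scheme.{0}, (F₁ ⟶ F₀) → Set F₁ → Prop), Q F₀ (𝟙 F₀) T₀ →
        (∀ (F₁ F₂ : Scheme.{0}) (ρ : F₁ ⟶ F₀) (T₁ : Set F₁)
          (x : ↥(vanishingIdeal (⟨closure T₁, isClosed_closure⟩ : Closeds F₁)).subscheme) (υ : F₂ ⟶ F₁)
          (hx : IsClosed ({((vanishingIdeal (⟨closure T₁, isClosed_closure⟩ : Closeds F₁)).subschemeι x : F₁)} : Set F₁)),
          Q F₁ ρ T₁ →
          ¬ IsRegularLocalRing ((vanishingIdeal (⟨closure T₁, isClosed_closure⟩ : Closeds F₁)).subscheme.presheaf.stalk x) →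
          IsBlowup υ (vanishingIdeal
            (⟨{((vanishingIdeal (⟨closure T₁, isClosed_closure⟩ : Closeds F₁)).subschemeι x : F₁)}, hx⟩ : Closeds F₁)) →
          Q F₂ (υ ≫ ρ) (closure (υ ⁻¹' (T₁ \
            {((vanishingIdeal (⟨closure T₁, isClosed_closure⟩ : Closeds F₁)).subschemeι x : F₁)})))) →
        Q F' ρ' T') ∧
      Scheme.IsRegular (vanishingIdeal (⟨closure T', isClosed_closure⟩ : Closeds F')).subscheme) :
    ∃ (X₂ : Scheme.{0}) (σ₂ : X₂ ⟶ X₁) (S₂ : Set X₂),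
      (∀ Q : (∀ X' : Scheme.{0}, (X' ⟶ X₁) → Set X' → Prop), Q X₁ (𝟙 X₁) (closure S₁) →
        (∀ (X' X'' : Scheme.{0}) (σ' : X' ⟶ X₁) (Y' : Set X') (C : X'.IdealSheafData) (τ : X'' ⟶ X'),
          Q X' σ' Y' → IsBlowup τ C → Scheme.IsRegular C.subscheme → Flat (C.subschemeι ≫ σ' ≫ σ₁ ≫ q) →
          σ' '' (C.support : Set X') ⊆ {x : X₁ | ¬ IsGenericPoint x (closure S₁)} →
          (C.support : Set X') ∩ (σ' ≫ σ₁ ≫ q) ⁻¹' {IsLocalRing.closedPoint O} ⊆ Y' →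
          Q X'' (τ ≫ σ') (closure (τ ⁻¹' (Y' \ (C.support : Set X'))))) →
        Q X₂ σ₂ S₂) ∧
      (∀ Q : (∀ X' : Scheme.{0}, (X' ⟶ P) → Set X' → Prop), Q P (𝟙 P) (Y : Set P) →
        (∀ (X' X'' : Scheme.{0}) (σ' : X' ⟶ P) (Y' : Set X') (C : X'.IdealSheafData) (τ : X'' ⟶ X'),
          Q X' σ' Y' → IsBlowup τ C → Scheme.IsRegular C.subscheme → Flat (C.subschemeι ≫ σ' ≫ q) →
          σ' '' (C.support : Set X') ⊆ {x : P | ¬ IsGenericPoint x (Y : Set P)} →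
          (C.support : Set X') ∩ (σ' ≫ q) ⁻¹' {IsLocalRing.closedPoint O} ⊆ Y' →
          Q X'' (τ ≫ σ') (closure (τ ⁻¹' (Y' \ (C.support : Set X'))))) →
        Q X₂ (σ₂ ≫ σ₁) S₂) ∧
      IsIrreducible ((σ₂ ≫ σ₁ ≫ q) ⁻¹' {IsLocalRing.closedPoint O}) ∧
      (∀ w : X₂, (σ₂ ≫ σ₁ ≫ q) w = IsLocalRing.closedPoint O → GoodAt (σ₂ ≫ σ₁ ≫ q) w) ∧
      Scheme.IsRegular (vanishingIdeal (⟨closure S₂, isClosed_closure⟩ : Closeds X₂)).subscheme := by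
  -- the new base `(X₁, σ₁ ≫ q, closure S₁)`: proper (a chain over the proper `P`), `closure S₁` closed irreducible inside the
  -- special fibre (`Chain.fibre`, `closure_subset_preimage_of_chain`)
  haveI := hq
  haveI := hqp
  have hPnoeth : IsLocallyNoetherian P := LocallyOfFiniteType.isLocallyNoetherian q
  have hPreg : Scheme.IsRegular P := fun y => (stub_goodAtOfSmooth O P q hq y).1
  have hch : Chain P (Y : Set P) X₁ σ₁ S₁ := chain_of_horizChainE1 q (Y : Set P) σ₁ S₁ hH
  obtain ⟨-, -, hσ₁⟩ := chain_isRegular P (Y : Set P) X₁ σ₁ S₁ hch hPnoeth hPreg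
  haveI := hσ₁
  have hqp₁ : IsProper (σ₁ ≫ q) := inferInstance
  obtain ⟨ξ, hξ⟩ : ∃ ξ : P, IsGenericPoint ξ (Y : Set P) := QuasiSober.sober hYirr Y.isClosed
  obtain ⟨ξ₁, -, hS₁⟩ := hch.fibre hξ
  have hS₁irr : IsIrreducible (closure S₁) := by
    rw [hS₁, closure_closure]; exact isIrreducible_singleton.closure
  have hS₁sub : closure S₁ ⊆ (σ₁ ≫ q) ⁻¹' {IsLocalRing.closedPoint O} :=
    closure_subset_preimage_of_chain q hYirr Y.isClosed hY hch
  let Y₁ : Closeds X₁ := ⟨closure S₁, isClosed_closure⟩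
  obtain ⟨X₂, σ₂, S₂, hH₂, hirr₂, hgood₂, hreg₂⟩ := pointResolution_base O X₁ (σ₁ ≫ q) Y₁ hsm₁ hqp₁ hirr hS₁sub hS₁irr
    F₀ T₀ hT₀cl hT₀irr e hres
  refine ⟨X₂, σ₂, S₂, hH₂, ?_, ?_, ?_, hreg₂⟩
  · exact horizChainE1_comp q hξ hH hH₂
  · simpa only [Category.assoc] using hirr₂
  · simpa only [Category.assoc] using hgood₂

end Summit.ResolutionOfSingularities.ResolutionOfSingularities.Cruxes.EquisingularLiftNat.Sections

end
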